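import Summits.MatrixMultiplication.OmegaCensus.STPPVosperSlackOneCoverLawA2P
import Summits.MatrixMultiplication.OmegaCensus.STPPVosperCoverP235Tables
import Summits.MatrixMultiplication.OmegaCensus.STPPVosperCoverP235Rows
import Summits.MatrixMultiplication.OmegaCensus.STPPVosperCoverP235Alpha
import Summits.MatrixMultiplication.OmegaCensus.STPPVosperTilingWordsPrunedQ
import Summits.MatrixMultiplication.OmegaCensus.STPPHamidouneRodsethInverseTheorem
import Summits.MatrixMultiplication.OmegaCensus.STPPVosperCoverKill235Z59
import Summits.MatrixMultiplication.OmegaCensus.STPPDisjointPacking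

/-!
# ω-census (abelian STPP census): `{(2,3,5),(3,2,5)}` has no STPP family in `ℤ/59ℤ` — UNCONDITIONAL kernel kill by the slack-1 cover law WITH THE A-PAIRING OF `W` (kernel)

HONEST FRAMING (pub-omega census; verbatim): lottery ticket; floor = certified bounds/negative ranges.
Census STRUCTURE (seat pub-omega-stpp-2 gen 26, 2026-08-28; leaf assigned by RULING L37-114 (c)), family (b2).  The pattern (`30 + 30 = 60 > 59`) is a leaf of
the `ℤ₅₉` residual front of record: the window-table laws leave the survivors `29, 30` (and `4, 55`), and seat stpp-2 gen 25 showed that `29, 30` survive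
even the exact-cover stage with the Def-5.1 words in cases γ and β (DATUM-cover-words-leaves).  They do NOT survive the A-PAIRING of the block sum-set `W`
(`STPPVosperSlackOnePairing.lean`): `W = Cᵢ + (−Aᵢ) − Bᵢ` must be a disjoint union of five translates of `{0, j} − [0,3)`, which no row of ratio `29, 30` admits
in any case (`STPPVosperCoverP235Tables.lean`, `…Alpha.lean`).  The remaining ratios `4, 55` (γ, β) and `4, 19, 20, 39, 40, 55` (α₂) die at the cover+words
stage: the single other block `(3,2,5)` has no word-admissible placement against `Y°`, `Z°` (`STPPVosperCoverP235Rows.lean`, `…Alpha.lean`; enumerator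
`blockDiffsWQ`).  Reading: the family `(A, B, C)` itself, block `0` = `(2,3,5)`: `(z, L, vol, m, n) = (15, 10, 30, 11, 41)`, slack one.  Law:
`no_isSTPP_of_slack_one_coverP_prime_a2` (`STPPVosperSlackOneCoverLawA2P.lean`) with `blockEnumSound_blockDiffsWQ` and `hamidouneRodsethInverseTheorem_holds`
— UNCONDITIONAL.  Python: HOME `pub-omega-stpp-2-g26/code/coverby_mirror.py`, `survey_235.py`, `wtile2.py`; independent: seat stpp-2 gen 25's
`blocki_235325.py` (block-i stage, 12/12 configurations without completion).  Nothing here is progress on `ω`.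

References: H. Cohn, R. Kleinberg, B. Szegedy, C. Umans, FOCS 2005 (arXiv:math/0511460), Def. 5.1; A. G. Vosper, J. London Math. Soc. 31 (1956);
Y. O. Hamidoune, Ø. J. Rødseth, Acta Arith. 92 (2000) 251–262.
-/

open Finset
open scoped Pointwise

namespace Summit.MatrixMultiplication.OmegaCensus.CubeNB

open Literature.Computability.AlgebraicComplexity
open Literature.Combinatorics.Additive
open Summit.MatrixMultiplication.OmegaCensus.STPPKneser

/-! ## Splits of the targets -/

section Splits

/-- Split of the γ target: words, or (`j = 4, 55`) the failed searches for every missing index. [folklore] -/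
theorem splitP235_gamma : ∀ jv ∈ ({0, 1, 58, 2, 57, 4, 55} : Finset ℕ),
    (jv = 0 ∨ (∃ k ∈ range 3, 1 ≤ k ∧ (jv = k ∨ jv + k = 59)) ∨ (∃ k ∈ range 2, 1 ≤ k ∧ (jv * k % 59 = 1 ∨ jv * k % 59 = 59 - 1))) ∨
      ∀ ν < 15 + 1, existsCoverW 59 ((List.range 10).map fun t => (jv * t) % 59) ((List.range (15 + 1)).filter fun t => decide (t ≠ ν))
      ([(3, 2, 5)].map fun s => blockDiffsWQ 59 ((List.range 10).map fun t => (jv * t) % 59) ((List.range (15 + 1)).filter fun t => decide (t ≠ ν)) s.1 s.2.1 s.2.2) [] [] [] = false ∨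
        existsCoverW 59 ((List.range (15 + 1)).filter fun t => decide (t ≠ ν)) ((List.range 10).map fun t => (jv * t) % 59)
      ([(2, 3, 5)].map fun s => blockDiffsWQ 59 ((List.range (15 + 1)).filter fun t => decide (t ≠ ν)) ((List.range 10).map fun t => (jv * t) % 59) s.1 s.2.1 s.2.2) [] [] [] = false := by
  intro jv hjv
  have hcases : jv ∈ ({0, 1, 58, 2, 57} : Finset ℕ) ∨ jv = 4 ∨ jv = 55 := by
    revert hjv; revert jv; decide
  rcases hcases with h | rfl | rfl
  · exact Or.inl (words59_2_3 jv h)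
  · exact Or.inr cp235_g_j4
  · exact Or.inr cp235_g_j55

/-- Split of the β target: words, or (`j = 4, 55`) the failed searches. [folklore] -/
theorem splitP235_beta : ∀ jv ∈ ({0, 1, 58, 2, 57, 4, 55} : Finset ℕ),
    (jv = 0 ∨ (∃ k ∈ range 3, 1 ≤ k ∧ (jv = k ∨ jv + k = 59)) ∨ (∃ k ∈ range 2, 1 ≤ k ∧ (jv * k % 59 = 1 ∨ jv * k % 59 = 59 - 1))) ∨
      ((∀ k < 3 + 41 + 1, (2 ≤ k ∧ k + 2 ≤ 3 + 41) ∨ k = 0 ∨ k = 3 + 41 ∨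
          (existsCoverW 59 ((List.range 10).map fun t => (jv * t) % 59) (List.range (15 - 1) ++ [k + 15 - 1])
      ([(3, 2, 5)].map fun s => blockDiffsWQ 59 ((List.range 10).map fun t => (jv * t) % 59) (List.range (15 - 1) ++ [k + 15 - 1]) s.1 s.2.1 s.2.2) [] [] [] = false ∨
            existsCoverW 59 (List.range (15 - 1) ++ [k + 15 - 1]) ((List.range 10).map fun t => (jv * t) % 59)
      ([(2, 3, 5)].map fun s => blockDiffsWQ 59 (List.range (15 - 1) ++ [k + 15 - 1]) ((List.range 10).map fun t => (jv * t) % 59) s.1 s.2.1 s.2.2) [] [] [] = false)) ∧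
        (existsCoverW 59 ((List.range 10).map fun t => (jv * t) % 59) (List.range 15)
      ([(3, 2, 5)].map fun s => blockDiffsWQ 59 ((List.range 10).map fun t => (jv * t) % 59) (List.range 15) s.1 s.2.1 s.2.2) [] [] [] = false ∨
          existsCoverW 59 (List.range 15) ((List.range 10).map fun t => (jv * t) % 59)
      ([(2, 3, 5)].map fun s => blockDiffsWQ 59 (List.range 15) ((List.range 10).map fun t => (jv * t) % 59) s.1 s.2.1 s.2.2) [] [] [] = false)) := by
  intro jv hjv
  have hcases : jv ∈ ({0, 1, 58, 2, 57} : Finset ℕ) ∨ jv = 4 ∨ jv = 55 := by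
    revert hjv; revert jv; decide
  rcases hcases with h | rfl | rfl
  · exact Or.inl (words59_2_3 jv h)
  · exact Or.inr cp235_b_j4
  · exact Or.inr cp235_b_j55

end Splits

/-! ## The kill -/

section Kill

/-- **`{(2,3,5),(3,2,5)}` has no STPP family in `ℤ/59ℤ`** — UNCONDITIONAL (slack-1 law for `a = 2` with the A-pairing of `W` and cover+words escapes,
family `(A, B, C)`, block `0`; see the module docstring). [cite: CohnKleinbergSzegedyUmans2005, Def. 5.1] [cite: Vosper1956, main theorem; Nathanson1996, Thm 2.7]
[cite: HamidouneRodseth2000, main theorem (§1, p. 252)] -/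
theorem no_isSTPP_zmod59_235_325 (A B C : Fin 2 → Finset (ZMod 59)) (hS : IsSTPP A B C)
    (hA : ∀ i, #(A i) = ![2, 3] i) (hB : ∀ i, #(B i) = ![3, 2] i) (hC : ∀ i, #(C i) = ![5, 5] i) : False := by
  haveI : Fact (Nat.Prime 59) := ⟨by norm_num⟩
  have hAne : ∀ i, (A i).Nonempty := fun i => card_pos.1 (by rw [hA]; fin_cases i <;> simp)
  have hBne : ∀ i, (B i).Nonempty := fun i => card_pos.1 (by rw [hB]; fin_cases i <;> simp)
  have hCne : ∀ i, (C i).Nonempty := fun i => card_pos.1 (by rw [hC]; fin_cases i <;> simp)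
  have e0 : (univ : Finset (Fin 2)).erase 0 = {1} := by decide
  have hz : ∑ k ∈ (univ : Finset (Fin 2)).erase 0, #(A k) * #(C k) = 15 := by rw [e0, Finset.sum_singleton]; simp [hA, hC]
  have hL : ∑ k ∈ (univ : Finset (Fin 2)).erase 0, #(B k) * #(C k) = 10 := by rw [e0, Finset.sum_singleton]; simp [hB, hC]
  have ha : #(A 0) = 2 := by rw [hA]; simp
  have hb : #(B 0) = 3 := by rw [hB]; simp
  have hvol : #(A 0) * #(B 0) * #(C 0) = 30 := by rw [hA, hB, hC]; simp
  have hsAB : [(3, 2, 5)] = ([1] : List (Fin 2)).map (fun k => (#(A k), #(B k), #(C k))) := by simp [hA, hB, hC]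
  have hsBA : [(2, 3, 5)] = ([1] : List (Fin 2)).map (fun k => (#(B k), #(A k), #(C k))) := by simp [hA, hB, hC]
  exact no_isSTPP_of_slack_one_coverP_prime_a2 (blockEnumSound_blockDiffsWQ 59) hamidouneRodsethInverseTheorem_holds A B C hS hAne hBne hCne 0
    ⟨1, by decide⟩ ha hb hvol hz hL rfl (by norm_num) (by norm_num) (by norm_num) (by norm_num) (m := 11) (n := 41) rfl rfl
    [1] (by decide) (fun k => by fin_cases k <;> decide) [(3, 2, 5)] hsAB [(2, 3, 5)] hsBA false
    (Jγ := {0, 1, 58, 2, 57, 4, 55}) (Jα := {0, 1, 58, 2, 57}) (Jβ := {0, 1, 58, 2, 57, 4, 55})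
    (tableGammaP_spec tableG59_41_11_3_P) splitP235_gamma specP235 words59_2_3 tableB59_42_11_3_P splitP235_beta

end Kill

end Summit.MatrixMultiplication.OmegaCensus.CubeNB
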